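import Summits.HodgeConjecture.HodgeConjecture.Theorems.Ring2WeilCoverageCMFieldNormResidueSymbolsRationalPrimesQuadratic
import Summits.HodgeConjecture.HodgeConjecture.Theorems.Ring2WeilCoverageCMFieldAllPrimes
import Summits.HodgeConjecture.HodgeConjecture.Theorems.Ring2WeilCoverageCMFieldCarrierGalois
import HarnessLib

/-!
# Ring 2 — Weil-family coverage, CM-field rows: the rational prime rule — RESIDUE TOOLKIT (Legendre symbols of
  `-1, ±2, ±3, ±5, 6, 10, 15` as congruence classes) and the dischargers of the odd radicand places
  (WEIL-FAMILY-COVERAGE «## b03», cell (xxi′), part 15)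

research route conditional on HC_CM; not a corollary; Q11.4-sentence-2 already refuted in dim ≥ 3.

Part 14 (`…RationalPrimesQuadratic`) proved, on Deligne's quadratic carriers `R = S² + pS + q` with a rational radicand
`θ = c²·b₀` [cite: Deligne1982HodgeCycles, §4 p. 30, (1), Cor. 4.2], the rule
`[ℓ] ≠ [(-1)^k] ⟺ (p² - 4q` square mod `ℓ) ∧ (b₀` non-square mod `ℓ)` for the odd primes `ℓ ∤ (p² - 4q)·b₀`, under two
field-level hypotheses (one dyadic place; the odd places of `b₀` harmless).  This file supplies what the fifteen
instances (parts 16–18) need to turn that into the census congruences of §b03.5/§b03.29: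

* §35 Legendre symbols at a VARIABLE prime `ℓ` as congruences (quadratic reciprocity, Mathlib; `5`, `3` from part IX-A):
  `(3|ℓ)`, `(-3|ℓ)`, `(5|ℓ)`, `(-5|ℓ)`, `(6|ℓ)`, `(10|ℓ)`, `(15|ℓ)` (`(-1|ℓ)`, `(±2|ℓ)` are Mathlib's), products and
  square factors; primes dividing `2^a 3^b 5^c`.
* §36 the odd places of the radicand: for `b₀ = -p₀` with `p₀` INERT in `F` (witnessed by an `s ∈ 𝓞_F`, `s² = d`,
  `d` a non-square mod `p₀`) every integer is a square at the place over `p₀`; for `p₀` RAMIFIED (`π² = p₀ w`,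
  `(p₀, w) = 1`) `ord b₀ = 2` is even — in both cases the hypothesis `hb` of part 14 holds for every prime `ℓ ≠ p₀`.
No new definition, no named fact, no sorry; nothing about the Hodge conjecture is asserted.
-/

noncomputable section

set_option linter.dupNamespace false

open Polynomial NumberField IsDedekindDomain

namespace Summit.HodgeConjecture.HodgeConjecture.Ring2.WeilCoverageCM

open Literature.AlgebraicGeometry.Deligne1982
open Literature.AlgebraicGeometry.HodgeTheory (splitDiscriminantClassCM)
open Literature.NumberTheory.QuadraticForms

/-! ### §35 Legendre symbols at a variable prime as congruence classes -/

section Residues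

variable {ℓ : ℕ}

/-- A prime dividing `2^a · 3^b · 5^c` is `2`, `3` or `5`. [folklore] -/
theorem eq_of_prime_dvd_two_pow_mul (hℓ : ℓ.Prime) {a b c : ℕ} (h : ℓ ∣ 2 ^ a * 3 ^ b * 5 ^ c) :
    ℓ = 2 ∨ ℓ = 3 ∨ ℓ = 5 := by
  rcases (Nat.Prime.dvd_mul hℓ).1 h with h | h
  · rcases (Nat.Prime.dvd_mul hℓ).1 h with h | h
    · exact Or.inl ((Nat.prime_dvd_prime_iff_eq hℓ Nat.prime_two).1 (hℓ.dvd_of_dvd_pow h))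
    · exact Or.inr (Or.inl ((Nat.prime_dvd_prime_iff_eq hℓ Nat.prime_three).1 (hℓ.dvd_of_dvd_pow h)))
  · exact Or.inr (Or.inr ((Nat.prime_dvd_prime_iff_eq hℓ Nat.prime_five).1 (hℓ.dvd_of_dvd_pow h)))

/-- In a field, `a·m²` is a square iff `a` is (`m ≠ 0`). [folklore] -/
theorem isSquare_mul_sq_iff_of_ne_zero {F : Type*} [Field F] {a m : F} (hm : m ≠ 0) :
    IsSquare (a * m ^ 2) ↔ IsSquare a := by
  constructor
  · rintro ⟨r, hr⟩
    exact ⟨r / m, by field_simp; linear_combination hr⟩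
  · rintro ⟨r, hr⟩
    exact ⟨r * m, by rw [hr]; ring⟩

variable [hℓ : Fact ℓ.Prime]

/-- **Product rule**: for integers `a, b` prime to `ℓ`, `ab` is a square mod `ℓ` iff `a` and `b` are both squares or
both non-squares (multiplicativity of the Legendre symbol). [folklore] -/
theorem isSquare_intCast_mul_iff {a b : ℤ} (ha : (a : ZMod ℓ) ≠ 0) (hb : (b : ZMod ℓ) ≠ 0) :
    IsSquare ((a : ZMod ℓ) * b) ↔ (IsSquare (a : ZMod ℓ) ↔ IsSquare (b : ZMod ℓ)) := by
  have hab : ((a * b : ℤ) : ZMod ℓ) ≠ 0 := by push_cast; exact mul_ne_zero ha hb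
  rw [show (a : ZMod ℓ) * b = ((a * b : ℤ) : ZMod ℓ) by push_cast; rfl, ← legendreSym.eq_one_iff ℓ hab,
    ← legendreSym.eq_one_iff ℓ ha, ← legendreSym.eq_one_iff ℓ hb, legendreSym.mul]
  rcases legendreSym.eq_one_or_neg_one ℓ ha with h1 | h1 <;>
    rcases legendreSym.eq_one_or_neg_one ℓ hb with h2 | h2 <;> norm_num [h1, h2]

/-- `(3|ℓ) = 1 ⟺ ℓ ≡ ±1 (mod 12)` (`ℓ ≠ 2, 3`; reciprocity with `3 ≡ 3 (mod 4)`). [folklore] -/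
theorem isSquare_three_iff (h2 : ℓ ≠ 2) (h3 : ℓ ≠ 3) : IsSquare (3 : ZMod ℓ) ↔ ℓ % 12 = 1 ∨ ℓ % 12 = 11 := by
  -- the residues of `ℓ` mod `3` (closed terms first)
  have sq1 : IsSquare ((1 : ℕ) : ZMod 3) := by decide
  have nsq2 : ¬ IsSquare ((2 : ℕ) : ZMod 3) := by decide
  have hℓ3 : IsSquare ((ℓ : ℕ) : ZMod 3) ↔ ℓ % 3 = 1 := by
    rw [← ZMod.natCast_mod ℓ 3]
    have h0 : ℓ % 3 ≠ 0 := fun h ↦ h3 ((Nat.prime_dvd_prime_iff_eq Nat.prime_three hℓ.out).1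
      (Nat.dvd_of_mod_eq_zero h)).symm
    have : ℓ % 3 = 1 ∨ ℓ % 3 = 2 := by omega
    rcases this with h | h <;> simp only [h]
    · exact iff_of_true sq1 trivial
    · exact iff_of_false nsq2 (by omega)
  haveI : Fact (Nat.Prime 3) := ⟨Nat.prime_three⟩
  have hodd : ℓ % 2 = 1 := (Nat.Prime.mod_two_eq_one_iff_ne_two hℓ.out).2 h2
  have h3' : ℓ % 3 ≠ 0 := fun h ↦ h3 ((Nat.prime_dvd_prime_iff_eq Nat.prime_three hℓ.out).1
    (Nat.dvd_of_mod_eq_zero h)).symm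
  by_cases h4 : ℓ % 4 = 1
  · have key := ZMod.exists_sq_eq_prime_iff_of_mod_four_eq_one (p := ℓ) (q := 3) h4 (by norm_num)
    rw [show (3 : ZMod ℓ) = ((3 : ℕ) : ZMod ℓ) by push_cast; rfl, key, hℓ3]
    omega
  · have h4' : ℓ % 4 = 3 := by omega
    have key := ZMod.exists_sq_eq_prime_iff_of_mod_four_eq_three (p := ℓ) (q := 3) h4' (by norm_num) h3
    rw [show (3 : ZMod ℓ) = ((3 : ℕ) : ZMod ℓ) by push_cast; rfl, key, hℓ3]
    omega

/-- `(5|ℓ) = 1 ⟺ ℓ ≡ ±1 (mod 5)` (`ℓ ≠ 2, 5`; part IX-A). [folklore] -/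
theorem isSquare_five_iff (h2 : ℓ ≠ 2) (h5 : ℓ ≠ 5) : IsSquare (5 : ZMod ℓ) ↔ ℓ % 5 = 1 ∨ ℓ % 5 = 4 := by
  have h0 : ℓ % 5 ≠ 0 := fun h ↦ h5 ((Nat.prime_dvd_prime_iff_eq Nat.prime_five hℓ.out).1
    (Nat.dvd_of_mod_eq_zero h)).symm
  by_cases h : ℓ % 5 = 1 ∨ ℓ % 5 = 4
  · exact iff_of_true (isSquare_five_of_mod_five h2 h) h
  · exact iff_of_false (not_isSquare_five_of_mod_five h2 (by omega)) h

/-- `(-3|ℓ) = 1 ⟺ ℓ ≡ 1 (mod 3)` (`ℓ ≠ 2, 3`). [folklore] -/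
theorem isSquare_neg_three_iff (h2 : ℓ ≠ 2) (h3 : ℓ ≠ 3) : IsSquare (-3 : ZMod ℓ) ↔ ℓ % 3 = 1 := by
  have hm1 : ((-1 : ℤ) : ZMod ℓ) ≠ 0 := by push_cast; exact neg_ne_zero.2 one_ne_zero
  have h3' : ((3 : ℤ) : ZMod ℓ) ≠ 0 := by exact_mod_cast natCast_prime_ne_zero_zmod Nat.prime_three h3
  have h := isSquare_intCast_mul_iff hm1 h3'
  push_cast at h
  rw [show (-3 : ZMod ℓ) = -1 * 3 by ring, h, ZMod.exists_sq_eq_neg_one_iff, isSquare_three_iff h2 h3]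
  have hodd : ℓ % 2 = 1 := (Nat.Prime.mod_two_eq_one_iff_ne_two hℓ.out).2 h2
  have h3'' : ℓ % 3 ≠ 0 := fun h ↦ h3 ((Nat.prime_dvd_prime_iff_eq Nat.prime_three hℓ.out).1
    (Nat.dvd_of_mod_eq_zero h)).symm
  omega

/-- `(-5|ℓ) = 1 ⟺ ℓ ≡ 1, 3, 7, 9 (mod 20)` (`ℓ ≠ 2, 5`). [folklore] -/
theorem isSquare_neg_five_iff (h2 : ℓ ≠ 2) (h5 : ℓ ≠ 5) :
    IsSquare (-5 : ZMod ℓ) ↔ ℓ % 20 = 1 ∨ ℓ % 20 = 3 ∨ ℓ % 20 = 7 ∨ ℓ % 20 = 9 := by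
  have hm1 : ((-1 : ℤ) : ZMod ℓ) ≠ 0 := by push_cast; exact neg_ne_zero.2 one_ne_zero
  have h5' : ((5 : ℤ) : ZMod ℓ) ≠ 0 := by exact_mod_cast natCast_prime_ne_zero_zmod Nat.prime_five h5
  have h := isSquare_intCast_mul_iff hm1 h5'
  push_cast at h
  rw [show (-5 : ZMod ℓ) = -1 * 5 by ring, h, ZMod.exists_sq_eq_neg_one_iff, isSquare_five_iff h2 h5]
  have hodd : ℓ % 2 = 1 := (Nat.Prime.mod_two_eq_one_iff_ne_two hℓ.out).2 h2
  have h5'' : ℓ % 5 ≠ 0 := fun h ↦ h5 ((Nat.prime_dvd_prime_iff_eq Nat.prime_five hℓ.out).1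
    (Nat.dvd_of_mod_eq_zero h)).symm
  have key : ∀ n : ℕ, n % 2 = 1 → n % 5 ≠ 0 →
      ((n % 4 ≠ 3 ↔ (n % 5 = 1 ∨ n % 5 = 4)) ↔ (n % 20 = 1 ∨ n % 20 = 3 ∨ n % 20 = 7 ∨ n % 20 = 9)) := by
    intro n hn2 hn5
    obtain ⟨k, r, hr, rfl⟩ : ∃ k r, r < 20 ∧ n = 20 * k + r :=
      ⟨n / 20, n % 20, Nat.mod_lt _ (by norm_num), (Nat.div_add_mod n 20).symm⟩
    interval_cases r <;> omega
  exact key ℓ hodd h5''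

/-- `(6|ℓ) = 1 ⟺ ℓ ≡ 1, 5, 19, 23 (mod 24)` (`ℓ ≠ 2, 3`). [folklore] -/
theorem isSquare_six_iff (h2 : ℓ ≠ 2) (h3 : ℓ ≠ 3) :
    IsSquare (6 : ZMod ℓ) ↔ ℓ % 24 = 1 ∨ ℓ % 24 = 5 ∨ ℓ % 24 = 19 ∨ ℓ % 24 = 23 := by
  have h2' : ((2 : ℤ) : ZMod ℓ) ≠ 0 := by exact_mod_cast natCast_prime_ne_zero_zmod Nat.prime_two h2
  have h3' : ((3 : ℤ) : ZMod ℓ) ≠ 0 := by exact_mod_cast natCast_prime_ne_zero_zmod Nat.prime_three h3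
  have h := isSquare_intCast_mul_iff h2' h3'
  push_cast at h
  rw [show (6 : ZMod ℓ) = 2 * 3 by norm_num, h, ZMod.exists_sq_eq_two_iff h2, isSquare_three_iff h2 h3]
  have hodd : ℓ % 2 = 1 := (Nat.Prime.mod_two_eq_one_iff_ne_two hℓ.out).2 h2
  have h3'' : ℓ % 3 ≠ 0 := fun h ↦ h3 ((Nat.prime_dvd_prime_iff_eq Nat.prime_three hℓ.out).1
    (Nat.dvd_of_mod_eq_zero h)).symm
  omega

/-- `(10|ℓ) = 1 ⟺ ℓ ≡ 1, 3, 9, 13, 27, 31, 37, 39 (mod 40)` (`ℓ ≠ 2, 5`). [folklore] -/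
theorem isSquare_ten_iff (h2 : ℓ ≠ 2) (h5 : ℓ ≠ 5) :
    IsSquare (10 : ZMod ℓ) ↔ ℓ % 40 = 1 ∨ ℓ % 40 = 3 ∨ ℓ % 40 = 9 ∨ ℓ % 40 = 13 ∨ ℓ % 40 = 27 ∨
      ℓ % 40 = 31 ∨ ℓ % 40 = 37 ∨ ℓ % 40 = 39 := by
  have h2' : ((2 : ℤ) : ZMod ℓ) ≠ 0 := by exact_mod_cast natCast_prime_ne_zero_zmod Nat.prime_two h2
  have h5' : ((5 : ℤ) : ZMod ℓ) ≠ 0 := by exact_mod_cast natCast_prime_ne_zero_zmod Nat.prime_five h5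
  have h := isSquare_intCast_mul_iff h2' h5'
  push_cast at h
  rw [show (10 : ZMod ℓ) = 2 * 5 by norm_num, h, ZMod.exists_sq_eq_two_iff h2, isSquare_five_iff h2 h5]
  have hodd : ℓ % 2 = 1 := (Nat.Prime.mod_two_eq_one_iff_ne_two hℓ.out).2 h2
  have h5'' : ℓ % 5 ≠ 0 := fun h ↦ h5 ((Nat.prime_dvd_prime_iff_eq Nat.prime_five hℓ.out).1
    (Nat.dvd_of_mod_eq_zero h)).symm
  have key : ∀ n : ℕ, n % 2 = 1 → n % 5 ≠ 0 →
      (((n % 8 = 1 ∨ n % 8 = 7) ↔ (n % 5 = 1 ∨ n % 5 = 4)) ↔ (n % 40 = 1 ∨ n % 40 = 3 ∨ n % 40 = 9 ∨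
        n % 40 = 13 ∨ n % 40 = 27 ∨ n % 40 = 31 ∨ n % 40 = 37 ∨ n % 40 = 39)) := by
    intro n hn2 hn5
    obtain ⟨k, r, hr, rfl⟩ : ∃ k r, r < 40 ∧ n = 40 * k + r :=
      ⟨n / 40, n % 40, Nat.mod_lt _ (by norm_num), (Nat.div_add_mod n 40).symm⟩
    interval_cases r <;> omega
  exact key ℓ hodd h5''

/-- `(15|ℓ) = 1 ⟺ ℓ ≡ 1, 7, 11, 17, 43, 49, 53, 59 (mod 60)` (`ℓ ≠ 2, 3, 5`). [folklore] -/
theorem isSquare_fifteen_iff (h2 : ℓ ≠ 2) (h3 : ℓ ≠ 3) (h5 : ℓ ≠ 5) :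
    IsSquare (15 : ZMod ℓ) ↔ ℓ % 60 = 1 ∨ ℓ % 60 = 7 ∨ ℓ % 60 = 11 ∨ ℓ % 60 = 17 ∨ ℓ % 60 = 43 ∨
      ℓ % 60 = 49 ∨ ℓ % 60 = 53 ∨ ℓ % 60 = 59 := by
  have h3' : ((3 : ℤ) : ZMod ℓ) ≠ 0 := by exact_mod_cast natCast_prime_ne_zero_zmod Nat.prime_three h3
  have h5' : ((5 : ℤ) : ZMod ℓ) ≠ 0 := by exact_mod_cast natCast_prime_ne_zero_zmod Nat.prime_five h5
  have h := isSquare_intCast_mul_iff h3' h5'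
  push_cast at h
  rw [show (15 : ZMod ℓ) = 3 * 5 by norm_num, h, isSquare_three_iff h2 h3, isSquare_five_iff h2 h5]
  have hodd : ℓ % 2 = 1 := (Nat.Prime.mod_two_eq_one_iff_ne_two hℓ.out).2 h2
  have h5'' : ℓ % 5 ≠ 0 := fun h ↦ h5 ((Nat.prime_dvd_prime_iff_eq Nat.prime_five hℓ.out).1
    (Nat.dvd_of_mod_eq_zero h)).symm
  have h3'' : ℓ % 3 ≠ 0 := fun h ↦ h3 ((Nat.prime_dvd_prime_iff_eq Nat.prime_three hℓ.out).1
    (Nat.dvd_of_mod_eq_zero h)).symm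
  have key : ∀ n : ℕ, n % 2 = 1 → n % 3 ≠ 0 → n % 5 ≠ 0 →
      (((n % 12 = 1 ∨ n % 12 = 11) ↔ (n % 5 = 1 ∨ n % 5 = 4)) ↔ (n % 60 = 1 ∨ n % 60 = 7 ∨ n % 60 = 11 ∨
        n % 60 = 17 ∨ n % 60 = 43 ∨ n % 60 = 49 ∨ n % 60 = 53 ∨ n % 60 = 59)) := by
    intro n hn2 hn3 hn5
    obtain ⟨k, r, hr, rfl⟩ : ∃ k r, r < 60 ∧ n = 60 * k + r :=
      ⟨n / 60, n % 60, Nat.mod_lt _ (by norm_num), (Nat.div_add_mod n 60).symm⟩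
    interval_cases r <;> omega
  exact key ℓ hodd h3'' h5''

end Residues

/-! ### §36 The odd places of the radicand `b₀ = -p₀`: inert (`d` non-square mod `p₀`) or ramified (`π² = p₀·w`) -/

section RadicandPlaces

variable {R : Polynomial ℤ} [Fact (Irreducible (realPolyQ R))]

/-- **Inert radicand prime**: if `𝓞_F ∋ s` with `s² = d`, `d` a NON-square mod the prime `p₀`, then at every place
`v ∋ p₀` of the quadratic field `F` the residue field is `𝔽_{p₀²}` (a residue field `𝔽_{p₀}` would contain `s̄² = d`),
so EVERY integer `ℓ` is a square mod `v`; with `ℓ ≠ p₀` prime, `ℓ ∉ v`.  This is hypothesis `hb` of part 14 for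
`b₀ = -p₀`. [folklore] -/
theorem radicand_places_of_inert (hK : Module.finrank ℚ (realField R) = 2) {s : 𝓞 (realField R)} {d : ℤ}
    (hs : s ^ 2 = d) {p₀ : ℕ} (hp₀ : p₀.Prime) (hnd : ¬ IsSquare ((d : ℤ) : ZMod p₀)) {ℓ : ℕ} (hℓ : ℓ.Prime)
    (hℓp : ℓ ≠ p₀) :
    ∀ v : HeightOneSpectrum (𝓞 (realField R)), (2 : 𝓞 (realField R)) ∉ v.asIdeal →
      ((-(p₀ : ℤ) : ℤ) : 𝓞 (realField R)) ∈ v.asIdeal →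
        (ℓ : 𝓞 (realField R)) ∉ v.asIdeal ∧
          (IsSquare (Ideal.Quotient.mk v.asIdeal (ℓ : 𝓞 (realField R))) ∨
            ¬ Odd (WithZero.log (v.valuation (realField R)
              (((-(p₀ : ℤ) : ℤ) : 𝓞 (realField R)) : realField R)))) := by
  intro v _ hpv
  have hpv' : (p₀ : 𝓞 (realField R)) ∈ v.asIdeal := by
    have := v.asIdeal.neg_mem hpv; push_cast at this; simpa using this
  have hN : Ideal.absNorm v.asIdeal = p₀ ^ 2 := by
    rcases absNorm_eq_or_eq_sq_of_natCast_mem hK v hp₀ hpv' with h | h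
    · exfalso
      refine hnd ((isSquare_intCast_residue_iff_of_absNorm_eq v hp₀ h d).1 ⟨Ideal.Quotient.mk v.asIdeal s, ?_⟩)
      rw [← map_mul, ← sq, hs]
    · exact h
  refine ⟨?_, Or.inl ?_⟩
  · have hcop : IsCoprime (p₀ : ℤ) ℓ := by
      rw [Int.isCoprime_iff_gcd_eq_one, Int.gcd_natCast_natCast]
      exact (Nat.coprime_primes hp₀ hℓ).2 (Ne.symm hℓp)
    have := intCast_notMem_of_isCoprime v hcop (by push_cast; exact hpv')
    push_cast at this
    exact this
  · have := isSquare_intCast_residue_of_absNorm_eq_sq v hp₀ hN ℓ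
    push_cast at this
    exact this

/-- **Ramified radicand prime**: if `π² = p₀·w` with `a·p₀ + b·w = 1` in `𝓞_F` (`F` quadratic), then at every place
`v ∋ p₀`: `ord_v(-p₀) = 2` is EVEN, and `ℓ ∉ v` for a prime `ℓ ≠ p₀` — hypothesis `hb` of part 14 for `b₀ = -p₀`.
[folklore] -/
theorem radicand_places_of_ramified (hK : Module.finrank ℚ (realField R) = 2) {p₀ : ℕ} (hp₀ : p₀.Prime)
    {π w a b : 𝓞 (realField R)} (hπ : π ^ 2 = p₀ * w) (hab : a * p₀ + b * w = 1) {ℓ : ℕ} (hℓ : ℓ.Prime)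
    (hℓp : ℓ ≠ p₀) :
    ∀ v : HeightOneSpectrum (𝓞 (realField R)), (2 : 𝓞 (realField R)) ∉ v.asIdeal →
      ((-(p₀ : ℤ) : ℤ) : 𝓞 (realField R)) ∈ v.asIdeal →
        (ℓ : 𝓞 (realField R)) ∉ v.asIdeal ∧
          (IsSquare (Ideal.Quotient.mk v.asIdeal (ℓ : 𝓞 (realField R))) ∨
            ¬ Odd (WithZero.log (v.valuation (realField R)
              (((-(p₀ : ℤ) : ℤ) : 𝓞 (realField R)) : realField R)))) := by
  intro v _ hpv
  have hpv' : (p₀ : 𝓞 (realField R)) ∈ v.asIdeal := by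
    have := v.asIdeal.neg_mem hpv; push_cast at this; simpa using this
  refine ⟨?_, Or.inr ?_⟩
  · have hcop : IsCoprime (p₀ : ℤ) ℓ := by
      rw [Int.isCoprime_iff_gcd_eq_one, Int.gcd_natCast_natCast]
      exact (Nat.coprime_primes hp₀ hℓ).2 (Ne.symm hℓp)
    have := intCast_notMem_of_isCoprime v hcop (by push_cast; exact hpv')
    push_cast at this
    exact this
  · have h := log_valuation_eq_neg_two_of_sq_eq_mul hK hp₀ hπ hab v hpv'
    have e : (((-(p₀ : ℤ) : ℤ) : 𝓞 (realField R)) : realField R) = -(p₀ : realField R) := by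
      rw [show (((-(p₀ : ℤ) : ℤ) : 𝓞 (realField R)) : realField R) = ((-(p₀ : ℤ) : ℤ) : realField R) from
        map_intCast (algebraMap (𝓞 (realField R)) (realField R)) _]
      push_cast; ring
    rw [e, Valuation.map_neg, h]
    decide

end RadicandPlaces

end Summit.HodgeConjecture.HodgeConjecture.Ring2.WeilCoverageCM

end
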